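import Mathlib
import Literature.MathematicalPhysics.StatisticalMechanics.Crystallization
import Literature.Algebra.EuclideanLattices.RegevPeriodicGaussianState

/-!
# FrustratedLawDichotomy · supercell re-presentation of a periodic configuration (route-independent re-home)
# (decomp-a2c, prover hand 2, structural share, generation 5 — groundwork for the unconditional periodic removal test)

`exists_supercell_points_energy`: for every periodic configuration `P` of `ℝᵈ` and `R ≥ 1` there is a periodic configuration with lattice
`R·Λ` (its periods are exactly the `R`-fold multiples of those of `P`), the same point set and the same energy per particle for every pair
potential; `tsum_site_eq_of_sub_mem_lattice`: site sums are invariant under lattice translations.  Both are ADAPTED VERBATIM from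
`PhononSlackCertificatesNearFarGlueRSupercell` (lens of route PhononSlackCertificates), whose import chain (`…NearFarGlueRTorusOfSep`) is
not built on the farm today, with the motif-averaging conjunct dropped; imports here are `Mathlib`, `Literature.…Crystallization` and
`Literature.Algebra.EuclideanLattices.RegevPeriodicGaussianState` only (transversal `Regev2009.reprSet` of `Λ/RΛ`).  `[folklore]`.
-/

noncomputable section

namespace Summit.AtomisticToContinuum.Crystallization.Theorems.FrustratedLawDichotomyPeriodicSupercell

open Literature.MathematicalPhysics.StatisticalMechanics
open Literature.Algebra.EuclideanLattices
open scoped BigOperators Classical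

variable {d : ℕ}

/-- **Site sums are invariant under lattice translations**: if `x' - x ∈ Λ` then
`Σ'_{y ∈ points, y ≠ x'} V(dist x' y) = Σ'_{y ∈ points, y ≠ x} V(dist x y)` (re-index by `y ↦ y + (x' - x)`, which permutes the point
set; cf. `PhononSlackCertificatesNearFarGlueRSupercell.tsum_site_eq_of_mem_lattice`, stated there for `x' = x + g`). [folklore] -/
theorem tsum_site_eq_of_sub_mem_lattice (P : PeriodicConfiguration d) (V : ℝ → ℝ)
    {x x' : EuclideanSpace ℝ (Fin d)} (hg : x' - x ∈ P.lattice) :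
    (∑' y : {y : EuclideanSpace ℝ (Fin d) // y ∈ P.points ∧ y ≠ x'}, V (dist x' y.1)) =
      ∑' y : {y : EuclideanSpace ℝ (Fin d) // y ∈ P.points ∧ y ≠ x}, V (dist x y.1) := by
  -- the translation equivalence between the two index types
  let e : {y : EuclideanSpace ℝ (Fin d) // y ∈ P.points ∧ y ≠ x} ≃
      {y : EuclideanSpace ℝ (Fin d) // y ∈ P.points ∧ y ≠ x'} :=
    { toFun := fun y => ⟨y.1 + (x' - x), P.add_mem_points y.2.1 hg, fun h => y.2.2 (by
          have : y.1 = x' - (x' - x) := eq_sub_of_add_eq h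
          rw [this]; abel)⟩
      invFun := fun y => ⟨y.1 - (x' - x), by
          have := P.add_mem_points y.2.1 (P.lattice.neg_mem hg)
          simpa [sub_eq_add_neg] using this, fun h => y.2.2 (by
          have : y.1 = x + (x' - x) := eq_add_of_sub_eq h
          rw [this]; abel)⟩
      left_inv := fun y => by ext1; simp
      right_inv := fun y => by ext1; simp }
  rw [← e.tsum_eq]
  refine tsum_congr fun y => ?_
  show V (dist x' (y.1 + (x' - x))) = V (dist x y.1)
  congr 1
  rw [dist_eq_norm, dist_eq_norm]
  congr 1
  abel
set_option maxHeartbeats 400000 in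
/-- **Supercell re-presentation** (adapted from `PhononSlackCertificatesNearFarGlueRSupercell.exists_supercell`, whose import chain is not
built on the farm today): for every periodic configuration `P` and every `R ≥ 1` there is a periodic configuration with lattice `R·Λ`, the
same point set and the same energy per particle for every pair potential. [folklore] -/
theorem exists_supercell_points_energy (P : PeriodicConfiguration d) (R : ℕ) [NeZero R] :
    ∃ P' : PeriodicConfiguration d,
      P'.points = P.points ∧
      (∀ V : ℝ → ℝ, P'.energyPerParticle V = P.energyPerParticle V) ∧
      (∀ g : EuclideanSpace ℝ (Fin d), g ∈ P'.lattice ↔ ∃ g₀ ∈ P.lattice, (R : ℝ) • g₀ = g) := by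
  -- a `ℤ`-basis of the lattice and the transversal of `Λ/RΛ`
  let Λ := P.lattice
  let ι := Module.Free.ChooseBasisIndex ℤ Λ
  let b : Module.Basis ι ℤ Λ := Module.Free.chooseBasis ℤ Λ
  let S : Finset (EuclideanSpace ℝ (Fin d)) := Regev2009.reprSet Λ b R
  have hS : Regev2009.IsTransversal Λ (Regev2009.scaledLattice Λ R) S :=
    Regev2009.isTransversal_reprSet Λ b R
  have hSsub : ∀ s ∈ S, s ∈ Λ := hS.subset
  have hRΛ : Regev2009.scaledLattice Λ R ≤ Λ := Regev2009.scaledLattice_le Λ R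
  -- the new motif `F + S`
  let f : EuclideanSpace ℝ (Fin d) × EuclideanSpace ℝ (Fin d) → EuclideanSpace ℝ (Fin d) :=
    fun p => p.1 + p.2
  have hinj : Set.InjOn f ↑(P.motif ×ˢ S) := by
    rintro ⟨y, s⟩ hys ⟨y', s'⟩ hys' h
    simp only [Finset.coe_product, Set.mem_prod, Finset.mem_coe] at hys hys'
    have hyy : y = y' := by
      refine P.eq_of_sub_mem y hys.1 y' hys'.1 ?_
      have h' : y + s = y' + s' := h
      have : y - y' = s' - s := by
        rw [sub_eq_sub_iff_add_eq_add, h', add_comm]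
      rw [this]
      exact Λ.sub_mem (hSsub _ hys'.2) (hSsub _ hys.2)
    subst hyy
    have hss : s = s' := add_left_cancel h
    rw [hss]
  let F' : Finset (EuclideanSpace ℝ (Fin d)) := (P.motif ×ˢ S).image f
  have hSne : S.Nonempty := by
    obtain ⟨x, hx, -⟩ := hS.unique 0 Λ.zero_mem
    exact ⟨x, hx.1⟩
  have hF'ne : F'.Nonempty := (P.motif_nonempty.product hSne).image f
  have hmemF' : ∀ z, z ∈ F' ↔ ∃ y ∈ P.motif, ∃ s ∈ S, z = y + s := by
    intro z
    simp only [F', Finset.mem_image, Finset.mem_product, Prod.exists, f]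
    constructor
    · rintro ⟨y, s, ⟨hy, hs⟩, rfl⟩; exact ⟨y, hy, s, hs, rfl⟩
    · rintro ⟨y, hy, s, hs, rfl⟩; exact ⟨y, s, ⟨hy, hs⟩, rfl⟩
  have hineq : ∀ z ∈ F', ∀ z' ∈ F', z - z' ∈ Regev2009.scaledLattice Λ R → z = z' := by
    intro z hz z' hz' hzz
    obtain ⟨y, hy, s, hs, rfl⟩ := (hmemF' z).1 hz
    obtain ⟨y', hy', s', hs', rfl⟩ := (hmemF' z').1 hz'
    have hyy : y = y' := by
      refine P.eq_of_sub_mem y hy y' hy' ?_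
      have : y - y' = (y + s - (y' + s')) - (s - s') := by abel
      rw [this]
      exact Λ.sub_mem (hRΛ hzz) (Λ.sub_mem (hSsub _ hs) (hSsub _ hs'))
    subst hyy
    have hss' : s - s' ∈ Regev2009.scaledLattice Λ R := by
      have : s - s' = y + s - (y + s') := by abel
      rw [this]; exact hzz
    -- both `s` and `s'` represent the class of `s`
    obtain ⟨x, -, hx⟩ := hS.unique s (hSsub _ hs)
    have h1 : s = x := hx s ⟨hs, by rw [sub_self]; exact Submodule.zero_mem _⟩
    have h2 : s' = x := hx s' ⟨hs', hss'⟩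
    rw [h1, h2]
  -- the supercell
  let P' : PeriodicConfiguration d :=
    { lattice := Regev2009.scaledLattice Λ R
      discrete := inferInstance
      isZLattice := inferInstance
      motif := F'
      motif_nonempty := hF'ne
      eq_of_sub_mem := hineq }
  -- same point set
  have hpts : P'.points = P.points := by
    ext z
    constructor
    · rintro ⟨w, hw, g', hg', rfl⟩
      obtain ⟨y, hy, s, hs, rfl⟩ := (hmemF' w).1 hw
      refine ⟨y, hy, s + g', Λ.add_mem (hSsub _ hs) (hRΛ hg'), ?_⟩
      abel
    · rintro ⟨y, hy, g, hg, rfl⟩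
      obtain ⟨s, ⟨hs, hgs⟩, -⟩ := hS.unique g hg
      refine ⟨y + s, (hmemF' _).2 ⟨y, hy, s, hs, rfl⟩, g - s, hgs, ?_⟩
      abel
  have hcardF' : F'.card = P.motif.card * S.card := by
    rw [Finset.card_image_of_injOn hinj, Finset.card_product]
  have hScard : (0 : ℝ) < S.card := by exact_mod_cast hSne.card_pos
  have hmcard : (0 : ℝ) < P.motif.card := by exact_mod_cast P.motif_nonempty.card_pos
  refine ⟨P', hpts, fun V => ?_, fun g => Regev2009.mem_scaledLattice Λ⟩
  -- same energy per particle
  have hsite : ∀ z, (∑' y : {y : EuclideanSpace ℝ (Fin d) // y ∈ P'.points ∧ y ≠ z}, V (dist z y.1)) =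
      ∑' y : {y : EuclideanSpace ℝ (Fin d) // y ∈ P.points ∧ y ≠ z}, V (dist z y.1) := by
    intro z
    rw [hpts]
  have hsum : ∑ z ∈ F', (∑' y : {y : EuclideanSpace ℝ (Fin d) // y ∈ P.points ∧ y ≠ z}, V (dist z y.1)) =
      (S.card : ℝ) * ∑ y ∈ P.motif,
        (∑' w : {w : EuclideanSpace ℝ (Fin d) // w ∈ P.points ∧ w ≠ y}, V (dist y w.1)) := by
    rw [Finset.sum_image hinj, Finset.sum_product, Finset.mul_sum]
    refine Finset.sum_congr rfl fun y _ => ?_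
    rw [Finset.sum_congr rfl fun s hs => tsum_site_eq_of_sub_mem_lattice P V (x := y) (x' := y + s) (by rw [add_sub_cancel_left]; exact hSsub s hs),
      Finset.sum_const, nsmul_eq_mul]
  show (2 * (F'.card : ℝ))⁻¹ * ∑ z ∈ F', (∑' y : {y // y ∈ P'.points ∧ y ≠ z}, V (dist z y.1)) =
    (2 * (P.motif.card : ℝ))⁻¹ * ∑ y ∈ P.motif, (∑' w : {w // w ∈ P.points ∧ w ≠ y}, V (dist y w.1))
  simp_rw [hsite]
  rw [hsum, hcardF', Nat.cast_mul]
  field_simp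

end Summit.AtomisticToContinuum.Crystallization.Theorems.FrustratedLawDichotomyPeriodicSupercell

end
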